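import Mathlib
import Literature.MathematicalPhysics.QuantumFieldTheory.Balaban1983to89.B6Lemma21Counterexample
import Literature.MathematicalPhysics.QuantumFieldTheory.Balaban1983to89.B6LevelTower

/-!
# `Balaban1983to89.B6Lemma21TowerD2` — T. Bałaban, *Propagators and renormalization transformations for lattice gauge
theories. II*, Commun. Math. Phys. **96** (1984) 223–250 [Balaban1984PropagatorsII]: the printed constant
`c₁(α) = 12c₀(½α)^d` of Lemma 2.1 (2.61) is exceeded ALSO IN d = 2 — kernel-checked on the coordinatised two-level tower
`B6LevelTower.twGeo` (L = 1024, αδ₀ = 1/128), hence `¬ B6.Lemma21Printed 2 δ₀ (tower)`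

statement-level skeleton of published theorems with citation tags; proofs where landed; nothing here is a claim about the Yang–Mills mass gap.
PDF held: `paper:balaban1984-cmp96-propagators-rt-ii` (journal page = PDF page + 222); pp. 231–234 [PDF 9–12] as read for
`…B6LevelTower` / `…B6Lemma21Counterexample` (same renders, `b2b-balaban-ref1/pages/1984-cmp96-propagators-rt-II/…`).

CITATION HEADER (cell `lit-balaban`, unit `lit-balaban-r03` gen 2, Phase-2 envelope seat p04 of `HOME/PHASE2-TARGETS.md`
§G.3: *"B6.Lem2.1 (d = 2 printed constant): decide «sup_y Σ e^{−αδ₀d} ≤ 12c₀(½α)²» on `B6LevelTower.twGeo` (prove or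
refute as printed)"*; SKELETON row `B6.Lem2.1` of `HOME/lit-balaban-r03/ROWS-B6.md`).  IMPORTED, not modified:
`…B6Lemma21Counterexample` (the d = 4, L = 32 slab witness; reused BY NAME: `c0_closed`, `sum_exp_ge_of_paths`) and
`…B6LevelTower` (the coordinatised level tower `TW`/`graph`/`tdist`/`twGeo` realising the multiscale distance (2.46);
reused BY NAME: `graph_connected`, `dist_le_latL1Dist_of_lvl`).
WHAT THE PAPER PRINTS (p. 233–234): *"c₀(α) = Σ_{z∈ℤ} e^{−αδ₀|z|}"*; (2.59) *"¼αδ₀RM > 2d log c₀(½α) + 1"*; Lemma 2.1: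
*"For the numbers α, 0 < α < 1, c₁(α) = 12c₀^d(½α), and RM satisfying (2.59) we have … sup_{y∈𝔅} Σ_{y′∈𝔅}
e^{−αδ₀d(y,y′)} ≤ c₁(α), (2.61)"* — typed verbatim as `B6.Lemma21Printed` / `B6RandomWalk.Ineq261`.
THE DECISION (d = 2): REFUTED AS PRINTED.  On the two-level tower (k = 1: a fine box Λ₀ = {0,…,A}² glued by the wall
bonds to the coarse box Λ₁ = {0,…,A}², scale ratio L = 1024, A = 1024·1537) take the fine wall point
y = (A, 1024·769).  The fine sites y′ = (A − t, 1024(m′+1) + r′ − 512), t < 768, m′ < 1536, r′ < 1024, are reached by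
the admissible contour «wall bond up, |m′ − 768| coarse bonds along the wall, wall bond down, |r′ − 512| + t fine bonds»
of 2 + t + |m′ − 768| + |r′ − 512| bonds, so Σ_{y′} e^{−ad(y,y′)} ≥ e^{−2a}·G₇₆₈·(1+q)G₇₆₈·(1+q)G₅₁₂ with q = e^{−a},
G_n = (1 − qⁿ)/(1 − q); at a = αδ₀ = 1/128 this is ≥ 8.0·10⁶ while 12c₀(½α)² = 12((1+e^{−1/256})/(1−e^{−1/256}))²
≤ 3.32·10⁶ (both sides enclosed by rationals from `Real.exp_neg_one_gt_d9`/`lt_d9` via q¹²⁸ = e^{−1}).  LOCATED CAUSE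
(same as d ≥ 3, GAPS G-A11-1): points of the FINER level next to a surface Σ_j are reached through the coarser lattice
at coarse cost, so the per-point count behind (2.58) is two-scale (≍ c₀³ in d = 2, not c₀²); for d = 2 this only bites
when L ≳ 100 and αδ₀ ≲ 1/60 (at L = 32, αδ₀ = ⅛ the printed constant still holds numerically, which is why the cell record
had «d = 2 undecided»).  The repaired constant 13c₀(½α)^{3d} (`B6Lemma21Arith.c1Repaired`, `B6Lemma21Repaired`) is
unaffected; all consumers use c₁ only as an O(1).
WHAT IS PROVED HERE (0 sorry, 0 named facts): §1 two-sided/one-sided geometric sums in closed form; §2 the d = 2 witness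
index set, its path-length budget and the factorised sum `fineSum`; §3 numerics at a = 1/128 (`q_lower`, `r_upper`,
`fineSum_lower`, `c1_two_upper`, **`fineSum_gt_c1`**); §4 the abstract assembled refutation `abstract_c1_exceeded_d2`
(any finite geometry carrying the witness family with the stated path bounds — the d = 2 twin of
`B6Lemma21Counterexample.printed_c1_exceeded`); §5 THE TOWER INSTANCE, where the path bounds are THEOREMS
(`adj_wall'`, `dist_witness_le`, `dist_fineSite_le`, `fineSite_injective`): **`tower_sum_gt_c1`**, **`not_ineq261_tower`** and
**`not_lemma21Printed_tower`** — for every δ₀ > 1/128 (α := 1/(128δ₀) ∈ ]0,1[, (2.59) verified for R = M = 1100) the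
verbatim `B6.Lemma21Printed 2 δ₀` FAILS on the tower family; `(2.2)` is vacuous for k = 1 exactly as in print (no index
1 ≤ j ≤ k − 1).  NOT claimed: anything about the torus shell geometries beyond the tower model, or about d ≥ 3 (settled
in `B6Lemma21Counterexample`).
COMPANION WITNESS TO p04 (p243253, `…B6Lemma21TwoDim`, seat of record for SKELETON row B6.Lem2.1 d = 2 under lead ruling
G.5-26): that file refutes the same printed constant on the same tower family in the regime αδ₀ ≤ 1/400, L = 1600
(generic small-αδ₀ estimates); the present file is an INDEPENDENT second witness in the different regime αδ₀ = 1/128,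
L = 1024 (explicit closed-form sums with decimal enclosures), in its own namespace — nothing of `…B6Lemma21TwoDim` is
imported or re-declared.
-/

namespace Literature.MathematicalPhysics.QuantumFieldTheory.Balaban1983to89.B6Lemma21TowerD2

open Finset Real
open B6Lemma21Counterexample (c0_closed sum_exp_ge_of_paths)
open B6LevelTower (TW lvl graph tdist twGeo graph_connected dist_le_latL1Dist_of_lvl)
open B6CoverTwoLevel (zv)
open Literature.Probability.LatticeModels (latL1Dist)

noncomputable section

/-! ## §1. Geometric sums -/

/-- `|k − N|` on ℕ (the lateral offset `|m′ − N|`, the residue offset `|r′ − 512|`). [folklore] -/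
def dev (N k : ℕ) : ℕ := if k < N then N - k else k - N

/-- `G_n(q) = Σ_{j<n} q^j`. [folklore] -/
def G (q : ℝ) (n : ℕ) : ℝ := ∑ j ∈ range n, q ^ j

/-- closed form `G_n(q) = (1 − qⁿ)/(1 − q)` for `q < 1`. [folklore] -/
private theorem G_closed {q : ℝ} (hq : q < 1) (n : ℕ) : G q n = (1 - q ^ n) / (1 - q) := by
  unfold G
  rw [geom_sum_eq hq.ne n, show q ^ n - 1 = -(1 - q ^ n) by ring, show q - 1 = -(1 - q) by ring, neg_div_neg_eq]

/-- `G_n(q) ≥ 0` for `q ≥ 0`. [folklore] -/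
private theorem G_nonneg {q : ℝ} (hq : 0 ≤ q) (n : ℕ) : 0 ≤ G q n :=
  Finset.sum_nonneg fun j _ => pow_nonneg hq j

/-- the two-sided sum: `Σ_{k<2N} q^{|k−N|} = (1 + q)·G_N(q)`. [folklore] -/
private theorem sum_twoSided (q : ℝ) (N : ℕ) : ∑ k ∈ range (2 * N), q ^ dev N k = (1 + q) * G q N := by
  rw [two_mul, Finset.sum_range_add]
  have h1 : ∑ k ∈ range N, q ^ dev N k = q * G q N := by
    unfold G
    rw [Finset.mul_sum, ← Finset.sum_range_reflect (fun k => q ^ dev N k) N]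
    refine Finset.sum_congr rfl fun j hj => ?_
    rw [Finset.mem_range] at hj
    have : dev N (N - 1 - j) = j + 1 := by unfold dev; split_ifs <;> omega
    rw [this, pow_succ, mul_comm]
  have h2 : ∑ k ∈ range N, q ^ dev N (N + k) = G q N := by
    unfold G
    refine Finset.sum_congr rfl fun j _ => ?_
    have : dev N (N + j) = j := by unfold dev; split_ifs <;> omega
    rw [this]
  rw [h1, h2]
  ring

/-! ## §2. The d = 2 witness family: indices, path budget, factorised sum -/

/-- index of a fine witness site: depth `t < 768`, lateral coarse cell `m′ < 1536`, residue `r′ < 1024` (a finite TYPE,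
so that no hypothesis below is a membership in a large explicit `Finset`). [folklore] -/
abbrev FineIdx2 : Type := Fin 768 × Fin 1536 × Fin 1024

/-- the path budget `2 + t + |m′ − 768| + |r′ − 512|` (wall, coarse travel, wall, fine travel).
[cite: Balaban1984PropagatorsII, (2.46)–(2.47) p.231] -/
def fineBound2 (i : FineIdx2) : ℝ := 2 + (i.1 : ℕ) + dev 768 i.2.1 + dev 512 i.2.2

/-- the factorised witness sum `q²·G₇₆₈·((1+q)G₇₆₈)·((1+q)G₅₁₂)`, `q = e^{−a}`. [folklore] -/
def fineSum (q : ℝ) : ℝ := q ^ 2 * G q 768 * ((1 + q) * G q 768) * ((1 + q) * G q 512)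

/-- `e^{−a·n} = (e^{−a})ⁿ`. [folklore] -/
private theorem exp_neg_mul_nat (a : ℝ) (n : ℕ) : Real.exp (-(a * n)) = Real.exp (-a) ^ n := by
  rw [← Real.exp_nat_mul]; congr 1; ring

/-- triple product factorisation of a sum over a product of finite types. [folklore] -/
private theorem sum_prod3 {A B C : Type*} [Fintype A] [Fintype B] [Fintype C] (f : A → ℝ) (g : B → ℝ)
    (h : C → ℝ) : ∑ i : A × B × C, f i.1 * (g i.2.1 * h i.2.2) = (∑ a, f a) * ((∑ b, g b) * ∑ c, h c) := by
  rw [Finset.sum_mul_sum, Finset.sum_mul_sum, Fintype.sum_prod_type]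
  refine Finset.sum_congr rfl fun a _ => ?_
  rw [Fintype.sum_prod_type]
  refine Finset.sum_congr rfl fun b _ => ?_
  rw [Finset.mul_sum]

/-- **factorisation**: `Σ_i e^{−a·fineBound2 i} = fineSum(e^{−a})`. [folklore] -/
private theorem sum_fineIdx2 (a : ℝ) : ∑ i : FineIdx2, Real.exp (-(a * fineBound2 i)) = fineSum (Real.exp (-a)) := by
  set q := Real.exp (-a) with hq
  have key : ∀ i : FineIdx2, Real.exp (-(a * fineBound2 i)) =
      q ^ 2 * (q ^ (i.1 : ℕ) * (q ^ dev 768 i.2.1 * q ^ dev 512 i.2.2)) := by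
    intro i
    have : fineBound2 i = ((2 + (i.1 : ℕ) + dev 768 i.2.1 + dev 512 i.2.2 : ℕ) : ℝ) := by
      unfold fineBound2; push_cast; ring
    rw [this, exp_neg_mul_nat, ← hq, pow_add, pow_add, pow_add]
    ring
  simp_rw [key]
  rw [← Finset.mul_sum]
  have h3 := sum_prod3 (fun t : Fin 768 => q ^ (t : ℕ)) (fun m : Fin 1536 => q ^ dev 768 m)
    (fun r : Fin 1024 => q ^ dev 512 r)
  rw [h3, Fin.sum_univ_eq_sum_range (fun t => q ^ t) 768,
    Fin.sum_univ_eq_sum_range (fun m => q ^ dev 768 m) 1536, Fin.sum_univ_eq_sum_range (fun r => q ^ dev 512 r) 1024]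
  have hm : ∑ m ∈ range 1536, q ^ dev 768 m = (1 + q) * G q 768 := by
    rw [show (1536 : ℕ) = 2 * 768 by norm_num]; exact sum_twoSided q 768
  have hr : ∑ r ∈ range 1024, q ^ dev 512 r = (1 + q) * G q 512 := by
    rw [show (1024 : ℕ) = 2 * 512 by norm_num]; exact sum_twoSided q 512
  rw [hm, hr]
  unfold fineSum G
  ring

/-! ## §3. Numerics at `a = αδ₀ = 1/128` -/

/-- `q = e^{−1/128} ≥ 0.9922` (from `q¹²⁸ = e^{−1} > 0.36787944116`). [folklore] -/
private theorem q_lower : (0.9922 : ℝ) ≤ Real.exp (-(1 / 128 : ℝ)) := by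
  by_contra hcon
  push Not at hcon
  have h := pow_lt_pow_left₀ hcon (Real.exp_pos _).le (by norm_num : (128 : ℕ) ≠ 0)
  have h128 : Real.exp (-(1 / 128 : ℝ)) ^ 128 = Real.exp (-1) := by
    rw [← Real.exp_nat_mul]; norm_num
  rw [h128] at h
  have := Real.exp_neg_one_gt_d9
  have : (0.9922 : ℝ) ^ 128 < 0.36787944116 := by norm_num
  linarith

/-- `r = e^{−1/256} ≤ 0.9962` (from `r²⁵⁶ = e^{−1} < 0.3678794412`). [folklore] -/
private theorem r_upper : Real.exp (-(1 / 256 : ℝ)) ≤ 0.9962 := by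
  by_contra hcon
  push Not at hcon
  have h := pow_lt_pow_left₀ hcon (by norm_num) (by norm_num : (256 : ℕ) ≠ 0)
  have h256 : Real.exp (-(1 / 256 : ℝ)) ^ 256 = Real.exp (-1) := by
    rw [← Real.exp_nat_mul]; norm_num
  rw [h256] at h
  have := Real.exp_neg_one_lt_d9
  have : (0.3678794412 : ℝ) < (0.9962 : ℝ) ^ 256 := by norm_num
  linarith

/-- `q⁷⁶⁸ = e^{−6} ≤ 0.0025`. [folklore] -/
private theorem q_pow_768_le : Real.exp (-(1 / 128 : ℝ)) ^ 768 ≤ 0.0025 := by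
  have h : Real.exp (-(1 / 128 : ℝ)) ^ 768 = Real.exp (-1) ^ 6 := by
    rw [← Real.exp_nat_mul, ← Real.exp_nat_mul]; norm_num
  rw [h]
  have h1 := Real.exp_neg_one_lt_d9
  have h2 : Real.exp (-1) ^ 6 ≤ (0.3678794412 : ℝ) ^ 6 :=
    pow_le_pow_left₀ (Real.exp_pos _).le h1.le 6
  have h3 : (0.3678794412 : ℝ) ^ 6 ≤ 0.0025 := by norm_num
  linarith

/-- `q⁵¹² = e^{−4} ≤ 0.0184`. [folklore] -/
private theorem q_pow_512_le : Real.exp (-(1 / 128 : ℝ)) ^ 512 ≤ 0.0184 := by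
  have h : Real.exp (-(1 / 128 : ℝ)) ^ 512 = Real.exp (-1) ^ 4 := by
    rw [← Real.exp_nat_mul, ← Real.exp_nat_mul]; norm_num
  rw [h]
  have h1 := Real.exp_neg_one_lt_d9
  have h2 : Real.exp (-1) ^ 4 ≤ (0.3678794412 : ℝ) ^ 4 :=
    pow_le_pow_left₀ (Real.exp_pos _).le h1.le 4
  have h3 : (0.3678794412 : ℝ) ^ 4 ≤ 0.0184 := by norm_num
  linarith

/-- `q < 1`. [folklore] -/
private theorem q_lt_one : Real.exp (-(1 / 128 : ℝ)) < 1 := by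
  rw [Real.exp_lt_one_iff]; norm_num

/-- `G₇₆₈(q) ≥ 127.8`. [folklore] -/
private theorem G768_lower : (127.8 : ℝ) ≤ G (Real.exp (-(1 / 128 : ℝ))) 768 := by
  have hq := q_lower
  have hq1 := q_lt_one
  have hP := q_pow_768_le
  rw [G_closed hq1, le_div_iff₀ (by linarith)]
  generalize Real.exp (-(1 / 128 : ℝ)) ^ 768 = P at hP ⊢
  generalize Real.exp (-(1 / 128 : ℝ)) = q at hq hq1 ⊢
  nlinarith

/-- `G₅₁₂(q) ≥ 125.8`. [folklore] -/
private theorem G512_lower : (125.8 : ℝ) ≤ G (Real.exp (-(1 / 128 : ℝ))) 512 := by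
  have hq := q_lower
  have hq1 := q_lt_one
  have hP := q_pow_512_le
  rw [G_closed hq1, le_div_iff₀ (by linarith)]
  generalize Real.exp (-(1 / 128 : ℝ)) ^ 512 = P at hP ⊢
  generalize Real.exp (-(1 / 128 : ℝ)) = q at hq hq1 ⊢
  nlinarith

/-- the witness sum at `a = 1/128` is `≥ 0.9922²·127.8·(1.9922·127.8)·(1.9922·125.8)` (≈ 8.03·10⁶). [folklore] -/
private theorem fineSum_lower :
    (0.9922 : ℝ) ^ 2 * 127.8 * (1.9922 * 127.8) * (1.9922 * 125.8) ≤ fineSum (Real.exp (-(1 / 128 : ℝ))) := by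
  set q := Real.exp (-(1 / 128 : ℝ)) with hq
  have h0 : (0.9922 : ℝ) ≤ q := q_lower
  have hq0 : 0 ≤ q := (Real.exp_pos _).le
  have h1 : (127.8 : ℝ) ≤ G q 768 := G768_lower
  have h2 : (125.8 : ℝ) ≤ G q 512 := G512_lower
  have hG1 : 0 ≤ G q 768 := G_nonneg hq0 768
  have hq2 : 0 ≤ q ^ 2 := pow_nonneg hq0 2
  have h1q : 0 ≤ 1 + q := by linarith
  have hA : (0.9922 : ℝ) ^ 2 ≤ q ^ 2 := pow_le_pow_left₀ (by norm_num) h0 2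
  have hB : (1.9922 * 127.8 : ℝ) ≤ (1 + q) * G q 768 := mul_le_mul (by linarith) h1 (by norm_num) h1q
  have hC : (1.9922 * 125.8 : ℝ) ≤ (1 + q) * G q 512 := mul_le_mul (by linarith) h2 (by norm_num) h1q
  have hAB : (0.9922 : ℝ) ^ 2 * 127.8 ≤ q ^ 2 * G q 768 := mul_le_mul hA h1 (by norm_num) hq2
  have hABC : (0.9922 : ℝ) ^ 2 * 127.8 * (1.9922 * 127.8) ≤ q ^ 2 * G q 768 * ((1 + q) * G q 768) :=
    mul_le_mul hAB hB (by norm_num) (mul_nonneg hq2 hG1)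
  unfold fineSum
  exact mul_le_mul hABC hC (by norm_num) (mul_nonneg (mul_nonneg hq2 hG1) (mul_nonneg h1q hG1))

/-- the printed constant at `αδ₀ = 1/128`, `d = 2`: `c₁(α) = 12c₀(½α)² ≤ 12·((1 + 0.9962)/(1 − 0.9962))²` (≈ 3.31·10⁶).
[cite: Balaban1984PropagatorsII, Lemma 2.1 p.234] -/
theorem c1_two_upper {δ₀ α : ℝ} (h : α * δ₀ = 1 / 128) :
    B6.c1 2 δ₀ α ≤ 12 * ((1 + 0.9962) / (1 - 0.9962)) ^ 2 := by
  have hpos : 0 < α / 2 * δ₀ := by nlinarith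
  have hc0 : B6.c0 δ₀ (α / 2) = (1 + Real.exp (-(1 / 256 : ℝ))) / (1 - Real.exp (-(1 / 256 : ℝ))) := by
    rw [c0_closed hpos]; congr 2 <;> (congr 1; congr 1; linarith)
  set r := Real.exp (-(1 / 256 : ℝ)) with hr
  have hr1 : r ≤ 0.9962 := r_upper
  have hr0 : 0 ≤ r := (Real.exp_pos _).le
  have hc0_le : B6.c0 δ₀ (α / 2) ≤ (1 + 0.9962) / (1 - 0.9962) := by
    rw [hc0, div_le_div_iff₀ (by linarith) (by norm_num)]
    nlinarith
  have hc0_nn : 0 ≤ B6.c0 δ₀ (α / 2) := by rw [hc0]; apply div_nonneg <;> linarith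
  unfold B6.c1
  have := pow_le_pow_left₀ hc0_nn hc0_le 2
  linarith

/-- **the printed constant is exceeded (d = 2, αδ₀ = 1/128):** `c₁(α) < fineSum(e^{−1/128})`.
[cite: Balaban1984PropagatorsII, Lemma 2.1 (2.61) p.234] -/
theorem fineSum_gt_c1 {δ₀ α : ℝ} (h : α * δ₀ = 1 / 128) : B6.c1 2 δ₀ α < fineSum (Real.exp (-(1 / 128 : ℝ))) := by
  have h1 := c1_two_upper h
  have h2 := fineSum_lower
  have h3 : (12 : ℝ) * ((1 + 0.9962) / (1 - 0.9962)) ^ 2 <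
      (0.9922 : ℝ) ^ 2 * 127.8 * (1.9922 * 127.8) * (1.9922 * 125.8) := by norm_num
  linarith

/-! ## §4. The abstract assembled refutation (any geometry carrying the witness family) -/

/-- witness lower bound: distinct witness sites within the path budget ⇒ `fineSum(e^{−a}) ≤ Σ_{y′} e^{−a·dist(y,y′)}`
(the (2.61) row sum dominates its witness part). [cite: Balaban1984PropagatorsII, Lemma 2.1 (2.61) p.234] -/
theorem fineSum_le_sum {S : Type*} [Fintype S] [DecidableEq S] (dist : S → S → ℝ) (y : S) (a : ℝ) (ha : 0 ≤ a)
    (f : FineIdx2 → S) (hinj : Function.Injective f) (hb : ∀ i, dist y (f i) ≤ fineBound2 i) :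
    fineSum (Real.exp (-a)) ≤ ∑ y' : S, Real.exp (-(a * dist y y')) := by
  rw [← sum_fineIdx2]
  exact sum_exp_ge_of_paths dist y a ha Finset.univ f hinj.injOn fineBound2 fun i _ => hb i

/-- **Assembled refutation of the printed (2.61) in d = 2** (abstract form, the twin of
`B6Lemma21Counterexample.printed_c1_exceeded`): in any finite geometry carrying the d = 2 witness family (distinct sites
within the path budget `fineBound2`), at `αδ₀ = 1/128` the (2.61) sum at the base point exceeds `c₁(α) = 12c₀(½α)²`.
[cite: Balaban1984PropagatorsII, Lemma 2.1 (2.61) p.234] -/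
theorem abstract_c1_exceeded_d2 {S : Type*} [Fintype S] [DecidableEq S] (dist : S → S → ℝ) (y : S)
    {δ₀ α : ℝ} (h : α * δ₀ = 1 / 128) (f : FineIdx2 → S) (hinj : Function.Injective f)
    (hb : ∀ i, dist y (f i) ≤ fineBound2 i) :
    B6.c1 2 δ₀ α < ∑ y' : S, Real.exp (-(α * δ₀ * dist y y')) := by
  have hw := fineSum_le_sum dist y (1 / 128) (by norm_num) f hinj hb
  rw [h]
  exact lt_of_lt_of_le (fineSum_gt_c1 h) hw

/-! ## §5. The tower instance: `twGeo 2 1 A M 1024 η R`, A = 1024·1537 -/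

section Tower

/-- the box parameter `A = 1024·1537 = 1573888` of the two-level tower (fine box and coarse box `{0,…,A}²`). -/
local notation "𝔸" => (1573888 : ℕ)

/-- clamped coordinate `x ↦ min x A : Fin (A+1)` (the identity on `x ≤ A`). [folklore] -/
def cl (x : ℕ) : Fin (𝔸 + 1) := ⟨min x 𝔸, by omega⟩

/-- `cl x = x` for `x ≤ A`. [folklore] -/
private theorem cl_val {x : ℕ} (hx : x ≤ 𝔸) : (cl x : ℕ) = x := min_eq_left hx

/-- a fine site (level 0) with coordinates `(x₀, x₁)`. [cite: Balaban1984PropagatorsII, (2.45) p.231] -/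
def mkFine (x0 x1 : ℕ) : TW 2 1 𝔸 := (0, ![cl x0, cl x1])

/-- a coarse site (level 1) with coordinates `(x₀, x₁)`. [cite: Balaban1984PropagatorsII, (2.45) p.231] -/
def mkCoarse (x0 x1 : ℕ) : TW 2 1 𝔸 := (1, ![cl x0, cl x1])

/-- the base point `y = (A, 1024·769)`: a fine point on the wall face `x₀ = A`, transversally at the coarse cell 769.
[cite: Balaban1984PropagatorsII, (2.61) p.234] -/
def baseY : TW 2 1 𝔸 := mkFine 𝔸 (1024 * 769)

/-- the fine witness site `(A − t, 1024(m′+1) + r′ − 512)`. [cite: Balaban1984PropagatorsII, (2.61) p.234] -/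
def fineSite (i : FineIdx2) : TW 2 1 𝔸 := mkFine (𝔸 - (i.1 : ℕ)) (1024 * ((i.2.1 : ℕ) + 1) + (i.2.2 : ℕ) - 512)

/-- `zv` of a two-vector of clamped coordinates. [folklore] -/
private theorem zv_pair {x0 x1 : ℕ} (h0 : x0 ≤ 𝔸) (h1 : x1 ≤ 𝔸) (μ : Fin 2) :
    zv ![cl x0, cl x1] μ = if μ = 0 then (x0 : ℤ) else (x1 : ℤ) := by
  fin_cases μ
  · simp [zv, cl_val h0]
  · simp [zv, cl_val h1]

/-- the ℓ¹ distance of two coordinate pairs. [folklore] -/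
private theorem latL1Dist_pair {x0 x1 x0' x1' : ℕ} (h0 : x0 ≤ 𝔸) (h1 : x1 ≤ 𝔸) (h0' : x0' ≤ 𝔸) (h1' : x1' ≤ 𝔸) :
    latL1Dist (zv ![cl x0, cl x1]) (zv ![cl x0', cl x1']) =
      ((x0 : ℤ) - x0').natAbs + ((x1 : ℤ) - x1').natAbs := by
  unfold latL1Dist
  rw [Fin.sum_univ_two, zv_pair h0 h1, zv_pair h0 h1, zv_pair h0' h1', zv_pair h0' h1']
  simp

/-- **a general wall bond of the tower**: the fine far-face point `(A, 1024·n)` and the coarse near-face point `(0, n)`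
are joined by an admissible bond (*"the points of Λ_{j+1} on the wall sit on the sublattice LΛ_j"*).
[cite: Balaban1984PropagatorsII, (2.46) p.231] -/
theorem adj_wall' (n : ℕ) (hn : 1024 * n ≤ 𝔸) :
    (graph 1024 : SimpleGraph (TW 2 1 𝔸)).Adj (mkFine 𝔸 (1024 * n)) (mkCoarse 0 n) := by
  have hn' : n ≤ 𝔸 := by omega
  rw [B6LevelTower.graph, SimpleGraph.fromRel_adj]
  refine ⟨fun h => absurd (congrArg Prod.fst h) (by simp [mkFine, mkCoarse]), Or.inl (Or.inr ⟨?_, ?_, ?_, ?_⟩)⟩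
  · simp [B6LevelTower.lvl, mkFine, mkCoarse]
  · simp [mkFine, cl_val (le_refl 𝔸)]
  · simp [mkCoarse, cl]
  · intro μ hμ
    have hμ1 : μ = 1 := by fin_cases μ <;> simp_all
    subst hμ1
    simp only [mkFine, mkCoarse]
    rw [zv_pair (le_refl 𝔸) hn, zv_pair (Nat.zero_le 𝔸) hn']
    push_cast
    simp

/-- in-level bound, coarse: from the wall cell `(0, 769)` to `(0, m′ + 1)` costs `≤ |m′ − 768|` coarse bonds.
[cite: Balaban1984PropagatorsII, (2.46) p.231] -/
theorem dist_coarse_lateral {m : ℕ} (hm : m < 1536) :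
    (graph 1024 : SimpleGraph (TW 2 1 𝔸)).dist (mkCoarse 0 769) (mkCoarse 0 (m + 1)) ≤ dev 768 m := by
  have h := dist_le_latL1Dist_of_lvl (d := 2) (k := 1) (a := 𝔸) 1024 1 ![cl 0, cl 769] ![cl 0, cl (m + 1)]
  have hlat : latL1Dist (zv ![cl 0, cl 769]) (zv ![cl 0, cl (m + 1)]) = dev 768 m := by
    rw [latL1Dist_pair (by norm_num) (by norm_num) (by norm_num) (by omega)]
    unfold dev
    split_ifs <;> omega
  rw [hlat] at h
  exact h

/-- in-level bound, fine: from the wall point `(A, 1024(m′+1))` to the witness site costs `≤ t + |r′ − 512|` fine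
bonds. [cite: Balaban1984PropagatorsII, (2.46) p.231] -/
theorem dist_fine_tail {t m r : ℕ} (ht : t < 768) (hm : m < 1536) (hr : r < 1024) :
    (graph 1024 : SimpleGraph (TW 2 1 𝔸)).dist (mkFine 𝔸 (1024 * (m + 1)))
      (mkFine (𝔸 - t) (1024 * (m + 1) + r - 512)) ≤ t + dev 512 r := by
  unfold mkFine
  have h := dist_le_latL1Dist_of_lvl (d := 2) (k := 1) (a := 𝔸) 1024 0 ![cl 𝔸, cl (1024 * (m + 1))]
    ![cl (𝔸 - t), cl (1024 * (m + 1) + r - 512)]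
  have hlat : latL1Dist (zv ![cl 𝔸, cl (1024 * (m + 1))]) (zv ![cl (𝔸 - t), cl (1024 * (m + 1) + r - 512)]) =
      t + dev 512 r := by
    rw [latL1Dist_pair (le_refl _) (by omega) (by omega) (by omega)]
    unfold dev
    split_ifs <;> omega
  rw [hlat] at h
  exact_mod_cast h

/-- **the path budget is met on the tower**, in bond counts: `d(y, y′) ≤ 2 + t + |m′ − 768| + |r′ − 512|` for the
witness site with parameters `t < 768`, `m′ < 1536`, `r′ < 1024` (wall bond, coarse travel along the wall, wall bond,
fine travel). [cite: Balaban1984PropagatorsII, (2.46)–(2.47) p.231] -/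
theorem dist_witness_le {t m r : ℕ} (ht : t < 768) (hm : m < 1536) (hr : r < 1024) :
    (graph 1024 : SimpleGraph (TW 2 1 𝔸)).dist baseY (mkFine (𝔸 - t) (1024 * (m + 1) + r - 512)) ≤
      2 + t + dev 768 m + dev 512 r := by
  have hc := graph_connected (d := 2) (k := 1) (a := 𝔸) 1024
  set z := mkFine (𝔸 - t) (1024 * (m + 1) + r - 512) with hz
  -- the four legs
  have h1 : (graph 1024 : SimpleGraph (TW 2 1 𝔸)).dist baseY (mkCoarse 0 769) = 1 :=
    SimpleGraph.dist_eq_one_iff_adj.mpr (adj_wall' 769 (by norm_num))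
  have h2 := dist_coarse_lateral hm
  have h3 : (graph 1024 : SimpleGraph (TW 2 1 𝔸)).dist (mkCoarse 0 (m + 1)) (mkFine 𝔸 (1024 * (m + 1))) = 1 :=
    SimpleGraph.dist_eq_one_iff_adj.mpr (adj_wall' (m + 1) (by omega)).symm
  have h4 : (graph 1024 : SimpleGraph (TW 2 1 𝔸)).dist (mkFine 𝔸 (1024 * (m + 1))) z ≤ t + dev 512 r :=
    dist_fine_tail ht hm hr
  -- triangle inequality thrice
  have tri1 := hc.dist_triangle (u := baseY) (v := mkCoarse 0 769) (w := z)
  have tri2 := hc.dist_triangle (u := mkCoarse 0 769) (v := mkCoarse 0 (m + 1)) (w := z)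
  have tri3 := hc.dist_triangle (u := mkCoarse 0 (m + 1)) (v := mkFine 𝔸 (1024 * (m + 1))) (w := z)
  omega

/-- the path budget in the form consumed by §4: `d(y, fineSite i) ≤ fineBound2 i` for every witness index.
[cite: Balaban1984PropagatorsII, (2.46)–(2.47) p.231] -/
theorem dist_fineSite_le (i : FineIdx2) : tdist 1024 baseY (fineSite i) ≤ fineBound2 i := by
  obtain ⟨t, m, r⟩ := i
  have h := dist_witness_le t.isLt m.isLt r.isLt
  unfold tdist fineBound2 fineSite
  exact_mod_cast h

/-- the witness sites are distinct (so the (2.61) row sum dominates the witness sum).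
[cite: Balaban1984PropagatorsII, Lemma 2.1 (2.61) p.234] -/
theorem fineSite_injective : Function.Injective fineSite := by
  rintro ⟨t, m, r⟩ ⟨t', m', r'⟩ h
  have ht := t.isLt
  have hm := m.isLt
  have hr := r.isLt
  have ht' := t'.isLt
  have hm' := m'.isLt
  have hr' := r'.isLt
  simp only [fineSite, mkFine, Prod.mk.injEq, true_and] at h
  have h0 := congrFun h 0
  have h1 := congrFun h 1
  simp only [Matrix.cons_val_zero, Matrix.cons_val_one] at h0 h1
  have e0 := congrArg Fin.val h0
  have e1 := congrArg Fin.val h1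
  rw [cl_val (by omega), cl_val (by omega)] at e0
  rw [cl_val (by omega), cl_val (by omega)] at e1
  simp only [Prod.mk.injEq]
  exact ⟨Fin.ext (by omega), Fin.ext (by omega), Fin.ext (by omega)⟩

/-- **(2.61) FAILS ON THE TOWER (d = 2):** at `αδ₀ = 1/128` the row sum `Σ_{y′∈𝔅} e^{−αδ₀d(y,y′)}` at the base point of the
two-level tower with L = 1024 exceeds the printed `c₁(α) = 12c₀(½α)²`.
[cite: Balaban1984PropagatorsII, Lemma 2.1 (2.61) p.234] -/
theorem tower_sum_gt_c1 {δ₀ α : ℝ} (h : α * δ₀ = 1 / 128) :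
    B6.c1 2 δ₀ α < ∑ y' : TW 2 1 𝔸, Real.exp (-(α * δ₀ * tdist 1024 baseY y')) :=
  abstract_c1_exceeded_d2 (tdist 1024) baseY h fineSite fineSite_injective dist_fineSite_le

/-- hence `B6RandomWalk.Ineq261` (the typed (2.61)) fails for the tower geometry `twGeo 2 1 A M 1024 η R` (any M, η, R)
whenever `αδ₀ = 1/128`. [cite: Balaban1984PropagatorsII, Lemma 2.1 (2.61) p.234] -/
theorem not_ineq261_tower {δ₀ α : ℝ} (h : α * δ₀ = 1 / 128) (M : ℕ) (η R : ℝ) :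
    ¬ B6RandomWalk.Ineq261 2 (twGeo 2 1 𝔸 M 1024 η R) δ₀ α := by
  intro H
  have h1 := H baseY
  have h2 := tower_sum_gt_c1 h
  exact absurd (lt_of_lt_of_le h2 h1) (lt_irrefl _)

/-- (2.59) holds at `αδ₀ = 1/128`, `d = 2` for `R = M = 1100`: `4·log c₀(½α) + 1 ≤ 4·(c₀ − 1) + 1 < RM/512`
(`c₀(½α) ≤ 525.4`). [cite: Balaban1984PropagatorsII, (2.59) p.233] -/
theorem cond259_tower {δ₀ α : ℝ} (h : α * δ₀ = 1 / 128) : B6.Cond259 2 δ₀ α 1100 1100 := by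
  have hpos : 0 < α / 2 * δ₀ := by nlinarith
  have hc0 : B6.c0 δ₀ (α / 2) = (1 + Real.exp (-(1 / 256 : ℝ))) / (1 - Real.exp (-(1 / 256 : ℝ))) := by
    rw [c0_closed hpos]; congr 2 <;> (congr 1; congr 1; linarith)
  set r := Real.exp (-(1 / 256 : ℝ)) with hr
  have hr1 : r ≤ 0.9962 := r_upper
  have hr0 : 0 < r := Real.exp_pos _
  have hc0_le : B6.c0 δ₀ (α / 2) ≤ (1 + 0.9962) / (1 - 0.9962) := by
    rw [hc0, div_le_div_iff₀ (by linarith) (by norm_num)]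
    nlinarith
  have hc0_pos : 0 < B6.c0 δ₀ (α / 2) := by rw [hc0]; apply div_pos <;> linarith
  have hlog : Real.log (B6.c0 δ₀ (α / 2)) ≤ B6.c0 δ₀ (α / 2) - 1 := Real.log_le_sub_one_of_pos hc0_pos
  unfold B6.Cond259
  have hαδ : (1 / 4 : ℝ) * α * δ₀ * 1100 * 1100 = 1100 * 1100 / 512 := by
    rw [show (1 / 4 : ℝ) * α * δ₀ * 1100 * 1100 = (1 / 4) * (α * δ₀) * 1100 * 1100 by ring, h]; norm_num
  rw [hαδ]
  push_cast
  have : (1 + 0.9962) / (1 - 0.9962) ≤ (526 : ℝ) := by norm_num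
  nlinarith

/-- **`B6.Lemma21Printed 2 δ₀` IS FALSE on the tower family**: for every δ₀ > 1/128 take α = 1/(128δ₀) ∈ ]0, 1[
(so αδ₀ = 1/128); (2.59) holds for R = M = 1100 (`cond259_tower`), the geometric hypothesis of the tower is vacuous
(k = 1, as in print), and the printed (2.61) fails at the base point (`tower_sum_gt_c1`).  Together with
`B6Lemma21Counterexample.printed_c1_exceeded` (d = 4) this settles the cell record's «d = 2 undecided»: the printed
constant of Lemma 2.1 is exceeded in d = 2 as well. [cite: Balaban1984PropagatorsII, Lemma 2.1 pp.233–234] -/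
theorem not_lemma21Printed_tower {δ₀ : ℝ} (hδ : 1 / 128 < δ₀) (η : ℝ) :
    ¬ B6.Lemma21Printed 2 δ₀ (fun _ : Unit => twGeo 2 1 𝔸 1100 1024 η 1100) := by
  intro H
  have hδ0 : 0 < δ₀ := lt_trans (by norm_num) hδ
  set α : ℝ := 1 / (128 * δ₀) with hα
  have hprod : α * δ₀ = 1 / 128 := by rw [hα]; field_simp
  have hα0 : 0 < α := by rw [hα]; positivity
  have hα1 : α < 1 := by
    rw [hα, div_lt_one (by positivity)]; linarith
  have hcond : B6.Cond259 2 δ₀ α (twGeo 2 1 𝔸 1100 1024 η 1100).R (twGeo 2 1 𝔸 1100 1024 η 1100).M := by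
    have := cond259_tower hprod
    simpa using this
  obtain ⟨_, h261⟩ := H () trivial α hα0 hα1 hcond
  exact not_ineq261_tower hprod 1100 η 1100 h261

end Tower

end

end Literature.MathematicalPhysics.QuantumFieldTheory.Balaban1983to89.B6Lemma21TowerD2
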